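import Summits.SmoothPoincare4.SmoothPoincare4.Theorems.ConvexBisectionAcyclicBisectionExistsDualHandlePushTubeImage
import Summits.SmoothPoincare4.SmoothPoincare4.Theorems.ConvexBisectionAcyclicBisectionExistsPushedPrefixAmbient
import Literature.Topology.FourManifolds.HandleAttachingMapsAssoc
import HarnessLib

/-!
# The pushed prefix sub-handlebody, II: the push on one tube is an immersion of the tube
(tool file 2/3 of brick (ii-2) "the global pushed embedding `jX₁' : X₁ → M'`" of the sub-goal T3b
of stub `stub_steinRealisation` (NF6), line `modp-braid-orbits` r11, crux
`ConvexBisection.AcyclicBisectionExists`, item stmt-SmoothPoincare4-10508; wave 4, lead c5,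
worker Y5)

Kosinski's tube `T = {y ∈ D⁴ | y_λ ≠ 0}` (`handleTube 3 2`) of an attaching circle
`γ = {‖y_λ‖ = 1}` carries Z3's push `S = PushModel.selfPush κ δ` (…DualHandlePushTubeSelf /
…TubeImage): a local diffeomorphism of `ℝ⁴` on the open `tubePushDom κ ⊇ T`, the identity where
`‖y_λ‖² ≤ 1 - 3κ²/4`, mapping `T` into `T ∖ γ`.  Here:

* `PushModel.selfPush_mem_tube` — `S(T) ⊆ T ∖ γ`: `‖S y‖ ≤ 1`, `0 < ‖(S y)_λ‖² < 1` for all `y ∈ T`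
  (also on `γ`, where `S y = √(1 - κ²/8) · (ŷ_λ, 0)`); `exists_tube_coe_eq_selfPush`,
  `exists_beltPiece_coe_eq_selfPush` (the pushed point as a point of `T ∖ γ`, resp. its `α`-image
  as a point of the belt piece), `selfPush_injOn_tube`, `selfPush_coe_of_le`;
* **`isImmersionAt_of_eq_comp_selfPush`** — if `Ĵ : T → N` (`N` a 4-manifold without boundary) is
  an immersion at every point of `T ∖ γ` and `K : T → N` satisfies `K y = Ĵ y'` whenever
  `y' = S y`, then `K` is an immersion at EVERY point of `T` (boundary points and `γ` included):
  `S` is packaged as a partial diffeomorphism of `ℝ⁴` and file 1/3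
  (`isImmersionAt_closedBall_of_eventuallyEq_comp`, Seeley extension) is applied;
* `helper_isImmersionAt_of_eq_comp_selfPush` (registered).

In file 3/3, `Ĵ = jM ∘ D₂.jA ∘ g_j` (gluing embedding after the attaching map) and
`K = jX₁' ∘ g_j`.  Everything here is proved; no named facts, no definitions.

## References
* A. A. Kosinski, *Differential Manifolds* (1993), VI §6. [Kosinski1993]
* J. Milnor, *Lectures on the h-cobordism theorem* (1965), §3. [MilnorHCobordism1965]
* J. M. Lee, *Introduction to Smooth Manifolds* (2013), Thm. 4.15. [LeeSmoothManifolds2013]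
-/

noncomputable section

-- the prescribed namespace `Summit.<P>.<Sub>.…` duplicates `SmoothPoincare4` (P = Sub)
set_option linter.dupNamespace false

open scoped Manifold ContDiff Topology

namespace Summit.SmoothPoincare4.SmoothPoincare4.Theorems.AcyclicBisectionExists.ModpBraidOrbits

open Set Function Metric Filter
open Literature.Topology.FourManifolds Literature.Topology.FourManifolds.HandleAttachingMap

namespace PushModel

section TubePoints

variable {κ δ : ℝ}

/-- **`S` maps the tube into the tube minus `γ`**: for `‖y‖ ≤ 1`, `y_λ ≠ 0`:
`‖S y‖ ≤ 1` and `0 < ‖(S y)_λ‖² < 1`. [cite: MilnorHCobordism1965, §3] -/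
theorem selfPush_mem_tube (hκ : 0 < κ) (hκ2 : κ ≤ 1 / 2) (hδ : 0 < δ) (hδ2 : δ ≤ 1 / 2)
    {y : EuclideanSpace ℝ (Fin 4)} (hy : ‖y‖ ≤ 1) (h0 : lamPart y ≠ 0) :
    ‖selfPush κ δ y‖ ≤ 1 ∧ 0 < sOf (selfPush κ δ y) ∧ sOf (selfPush κ δ y) < 1 := by
  have hs0 : 0 < sOf y := sOf_pos_iff.2 h0
  obtain ⟨hsum, hcirc⟩ := sOf_le_one_of_norm_le_one hy
  have hQ : 0 ≤ muN y := sq_nonneg _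
  rcases lt_or_ge (sOf y) 1 with h1 | h1
  · obtain ⟨a, b, c, -⟩ := selfPush_mem_of_lt hκ hκ2 hδ hδ2 hy hs0 h1
    exact ⟨a, b, c⟩
  · have hs1 : sOf y = 1 := le_antisymm (by linarith) h1
    have hμ : muPart y = 0 := hcirc hs1
    have hl : ‖lamPart y‖ = 1 := by
      have h := hs1
      rw [sOf] at h
      nlinarith [norm_nonneg (lamPart y)]
    have hp : 0 < pFun κ 0 := pFun_pos hκ le_rfl
    have hp1 : pFun κ 0 < 1 := pFun_zero_lt_one hκ hκ2
    have hc : sOf (Real.sqrt (1 - pFun κ 0) • lamEmbed (lamPart y)) = 1 - pFun κ 0 := by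
      rw [sOf, lamPart_smul, lamPart_lamEmbed, norm_sqrt_smul_sq (by linarith), hl, one_pow, mul_one]
    rw [selfPush_of_mem_circle hκ hκ2 hδ hl hμ]
    refine ⟨?_, by rw [hc]; linarith, by rw [hc]; linarith⟩
    rw [norm_smul, norm_lamEmbed, hl, mul_one, Real.norm_eq_abs, abs_of_nonneg (Real.sqrt_nonneg _),
      Real.sqrt_le_one]
    linarith

/-- The pushed point as a point of the tube off `γ`: `∃ y' ∈ T`, `y' = S y`, `‖y'_λ‖² ≠ 1`.
[folklore] -/
theorem exists_tube_coe_eq_selfPush (hκ : 0 < κ) (hκ2 : κ ≤ 1 / 2) (hδ : 0 < δ) (hδ2 : δ ≤ 1 / 2)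
    (y : ↥(handleTube 3 2)) :
    ∃ y' : ↥(handleTube 3 2),
      (((y' : Metric.closedBall (0 : EuclideanSpace ℝ (Fin 4)) 1) : EuclideanSpace ℝ (Fin 4)) =
        selfPush κ δ ((y : Metric.closedBall (0 : EuclideanSpace ℝ (Fin 4)) 1) : EuclideanSpace ℝ (Fin 4))) ∧
      lamSq 2 (((y' : Metric.closedBall (0 : EuclideanSpace ℝ (Fin 4)) 1) : EuclideanSpace ℝ (Fin 4))) ≠ 1 := by
  have hy0 : lamPart ((y : Metric.closedBall (0 : EuclideanSpace ℝ (Fin 4)) 1) : EuclideanSpace ℝ (Fin 4)) ≠ 0 :=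
    sOf_pos_iff.1 (by rw [sOf_eq_lamSq]; exact lt_of_le_of_ne (lamSq_nonneg 2 _) (Ne.symm y.2))
  obtain ⟨h1, h2, h3⟩ := selfPush_mem_tube hκ hκ2 hδ hδ2 (mem_closedBall_zero_iff.1 y.1.2) hy0
  rw [sOf_eq_lamSq] at h2 h3
  exact ⟨⟨⟨_, mem_closedBall_zero_iff.2 h1⟩, by rw [mem_handleTube]; exact h2.ne'⟩, rfl, h3.ne⟩

/-- The `α`-image of the pushed point as a point of the belt piece: `∃ b ∈ D⁴ ∖ S`,
`b = α (S y)`. [folklore] -/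
theorem exists_beltPiece_coe_eq_selfPush (hκ : 0 < κ) (hκ2 : κ ≤ 1 / 2) (hδ : 0 < δ) (hδ2 : δ ≤ 1 / 2)
    (y : ↥(handleTube 3 2)) :
    ∃ b : ↥(beltPiece 3 2),
      ((b : Metric.closedBall (0 : EuclideanSpace ℝ (Fin 4)) 1) : EuclideanSpace ℝ (Fin 4)) =
        handleInversion 2 (selfPush κ δ ((y : Metric.closedBall (0 : EuclideanSpace ℝ (Fin 4)) 1) : EuclideanSpace ℝ (Fin 4))) := by
  obtain ⟨y', hy', h1⟩ := exists_tube_coe_eq_selfPush hκ hκ2 hδ hδ2 y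
  obtain ⟨hm, -, h1'⟩ := handleInversion_mem (k := 2) y'.2 h1
  exact ⟨⟨⟨_, hm⟩, by rw [mem_beltPiece]; exact h1'⟩, by rw [← hy']⟩

/-- `S` is injective on the tube. [folklore] -/
theorem selfPush_injOn_tube (hκ : 0 < κ) (hκ2 : κ ≤ 1 / 2) (hδ : 0 < δ) :
    InjOn (selfPush κ δ) {y : EuclideanSpace ℝ (Fin 4) | ‖y‖ ≤ 1 ∧ lamPart y ≠ 0} := by
  intro y₁ h₁ y₂ h₂ h
  rw [← selfPushInv_selfPush hκ hκ2 hδ (puncturedBall_subset_tubePushDom hκ h₁), h,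
    selfPushInv_selfPush hκ hκ2 hδ (puncturedBall_subset_tubePushDom hκ h₂)]

/-- `S = id` on the tube where `‖y_λ‖² ≤ 1 - 3κ²/4`. [folklore] -/
theorem selfPush_coe_of_le (hκ : 0 < κ) (hκ2 : κ ≤ 1 / 2) (hδ : 0 < δ) (y : ↥(handleTube 3 2))
    (h : ‖lamPart ((y : Metric.closedBall (0 : EuclideanSpace ℝ (Fin 4)) 1) : EuclideanSpace ℝ (Fin 4))‖ ^ 2 ≤ 1 - 3 * κ ^ 2 / 4) :
    selfPush κ δ ((y : Metric.closedBall (0 : EuclideanSpace ℝ (Fin 4)) 1) : EuclideanSpace ℝ (Fin 4)) = y :=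
  selfPush_of_le hκ hκ2 hδ (by rw [sOf_eq_lamSq]; exact lt_of_le_of_ne (lamSq_nonneg 2 _) (Ne.symm y.2)) h

end TubePoints

end PushModel

/-! ### The tube piece is an immersion -/

section TubeImmersion

variable {N : Type*} [TopologicalSpace N] [ChartedSpace (EuclideanSpace ℝ (Fin 4)) N] [IsManifold (𝓡 4) ∞ N]
  {κ δ : ℝ}

open PushModel

open Classical in
/-- **THE PUSH ON A TUBE IS AN IMMERSION OF THE TUBE.**  Let `Ĵ : T → N` be an immersion at every
point of `T ∖ γ` (`N` a 4-manifold without boundary), and let `K : T → N` be `Ĵ ∘ S`: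
`K y = Ĵ y'` whenever `y' = selfPush κ δ y`.  Then `K` is an immersion at every point of `T`,
boundary points and `γ` included: `S` is a partial diffeomorphism of `ℝ⁴` on `tubePushDom κ ⊇ T`
with `S(T) ⊆ T ∖ γ`, and `Ĵ` is locally the restriction of an ambient immersion (file 1/3).
[cite: LeeSmoothManifolds2013, Thm. 4.15] -/
theorem isImmersionAt_of_eq_comp_selfPush (hκ : 0 < κ) (hκ2 : κ ≤ 1 / 2) (hδ : 0 < δ) (hδ2 : δ ≤ 1 / 2)
    {J K : ↥(handleTube 3 2) → N}
    (hJ : ∀ y : ↥(handleTube 3 2),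
      lamSq 2 (((y : Metric.closedBall (0 : EuclideanSpace ℝ (Fin 4)) 1) : EuclideanSpace ℝ (Fin 4))) ≠ 1 →
        Manifold.IsImmersionAt (𝓡∂ 4) (𝓡 4) ∞ J y)
    (hK : ∀ y y' : ↥(handleTube 3 2),
      (((y' : Metric.closedBall (0 : EuclideanSpace ℝ (Fin 4)) 1) : EuclideanSpace ℝ (Fin 4)) =
        selfPush κ δ ((y : Metric.closedBall (0 : EuclideanSpace ℝ (Fin 4)) 1) : EuclideanSpace ℝ (Fin 4))) →
      K y = J y')
    (y₀ : ↥(handleTube 3 2)) : Manifold.IsImmersionAt (𝓡∂ 4) (𝓡 4) ∞ K y₀ := by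
  -- `S` as a partial diffeomorphism of `ℝ⁴`
  let Φ : OpenPartialHomeomorph (EuclideanSpace ℝ (Fin 4)) (EuclideanSpace ℝ (Fin 4)) :=
    { toFun := selfPush κ δ
      invFun := selfPushInv κ δ
      source := tubePushDom κ
      target := selfPushInvDom κ δ
      map_source' := fun y hy => mapsTo_selfPush hκ hκ2 hδ hy
      map_target' := fun x hx => mapsTo_selfPushInv hκ hδ hx
      left_inv' := fun y hy => selfPushInv_selfPush hκ hκ2 hδ hy
      right_inv' := fun x hx => selfPush_selfPushInv hκ hκ2 hδ hx
      open_source := isOpen_tubePushDom hκ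
      open_target := isOpen_selfPushInvDom hκ δ
      continuousOn_toFun := (contDiffOn_selfPush hκ hκ2 hδ).continuousOn
      continuousOn_invFun := (contDiffOn_selfPushInv hκ hκ2 hδ).continuousOn }
  have hΦ : ContDiffOn ℝ ∞ Φ Φ.source := contDiffOn_selfPush hκ hκ2 hδ
  have hΦ' : ContDiffOn ℝ ∞ Φ.symm Φ.target := contDiffOn_selfPushInv hκ hκ2 hδ
  -- tube points are in the domain, and are pushed into `T ∖ γ`
  have hT : ∀ y : ↥(handleTube 3 2),
      ‖((y : Metric.closedBall (0 : EuclideanSpace ℝ (Fin 4)) 1) : EuclideanSpace ℝ (Fin 4))‖ ≤ 1 ∧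
        lamPart ((y : Metric.closedBall (0 : EuclideanSpace ℝ (Fin 4)) 1) : EuclideanSpace ℝ (Fin 4)) ≠ 0 := fun y =>
    ⟨mem_closedBall_zero_iff.1 y.1.2,
      sOf_pos_iff.1 (by rw [sOf_eq_lamSq]; exact lt_of_le_of_ne (lamSq_nonneg 2 _) (Ne.symm y.2))⟩
  have hS : ∀ y : ↥(handleTube 3 2),
      selfPush κ δ ((y : Metric.closedBall (0 : EuclideanSpace ℝ (Fin 4)) 1) : EuclideanSpace ℝ (Fin 4)) ∈
          Metric.closedBall (0 : EuclideanSpace ℝ (Fin 4)) 1 ∧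
        lamSq 2 (selfPush κ δ ((y : Metric.closedBall (0 : EuclideanSpace ℝ (Fin 4)) 1) : EuclideanSpace ℝ (Fin 4))) ≠ 0 ∧
        lamSq 2 (selfPush κ δ ((y : Metric.closedBall (0 : EuclideanSpace ℝ (Fin 4)) 1) : EuclideanSpace ℝ (Fin 4))) ≠ 1 := by
    intro y
    obtain ⟨h1, h2, h3⟩ := selfPush_mem_tube hκ hκ2 hδ hδ2 (hT y).1 (hT y).2
    rw [sOf_eq_lamSq] at h2 h3
    exact ⟨mem_closedBall_zero_iff.2 h1, h2.ne', h3.ne⟩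
  -- extensions of `J`, `K` to the closed ball
  set J' : Metric.closedBall (0 : EuclideanSpace ℝ (Fin 4)) 1 → N :=
    fun z => if hz : z ∈ handleTube 3 2 then J ⟨z, hz⟩ else J y₀ with hJ'
  set K' : Metric.closedBall (0 : EuclideanSpace ℝ (Fin 4)) 1 → N :=
    fun z => if hz : z ∈ handleTube 3 2 then K ⟨z, hz⟩ else J y₀ with hK'
  -- the pushed base point
  set y₁ : ↥(handleTube 3 2) := ⟨⟨_, (hS y₀).1⟩, by rw [mem_handleTube]; exact (hS y₀).2.1⟩ with hy₁
  have hJ₁ : Manifold.IsImmersionAt (𝓡∂ 4) (𝓡 4) ∞ J' (y₁ : Metric.closedBall (0 : EuclideanSpace ℝ (Fin 4)) 1) :=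
    isImmersionAt_opens_extend (handleTube 3 2) (J y₀) (hJ y₁ (hS y₀).2.2)
  -- the tool of file 1/3
  have hopen : {z : Metric.closedBall (0 : EuclideanSpace ℝ (Fin 4)) 1 | z ∈ handleTube 3 2} ∈
      𝓝 (y₀ : Metric.closedBall (0 : EuclideanSpace ℝ (Fin 4)) 1) :=
    (handleTube 3 2).isOpen.mem_nhds y₀.2
  have hK₀ : Manifold.IsImmersionAt (𝓡∂ 4) (𝓡 4) ∞ K' (y₀ : Metric.closedBall (0 : EuclideanSpace ℝ (Fin 4)) 1) := by
    refine isImmersionAt_closedBall_of_eventuallyEq_comp Φ hΦ hΦ'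
      (puncturedBall_subset_tubePushDom hκ (hT y₀)) (hS y₀).1 hJ₁ ?_ ?_
    · filter_upwards [hopen] with z hz hz'
      have hz₁ : (⟨Φ (z : EuclideanSpace ℝ (Fin 4)), hz'⟩ : Metric.closedBall (0 : EuclideanSpace ℝ (Fin 4)) 1) ∈ handleTube 3 2 := by
        rw [mem_handleTube]; exact (hS ⟨z, hz⟩).2.1
      have h1 : K' z = K ⟨z, hz⟩ := dif_pos hz
      have h2 : J' ⟨Φ (z : EuclideanSpace ℝ (Fin 4)), hz'⟩ = J ⟨⟨Φ (z : EuclideanSpace ℝ (Fin 4)), hz'⟩, hz₁⟩ := dif_pos hz₁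
      rw [h1, h2]
      exact hK ⟨z, hz⟩ _ rfl
    · filter_upwards [hopen] with z hz using (hS ⟨z, hz⟩).1
  -- back to the tube
  have h1 := (hK₀.isImmersionAtOfComplement_complement.comp_subtypeVal (handleTube 3 2) (y := y₀)).isImmersionAt
  refine h1.congr_of_eventuallyEq (Eventually.of_forall fun y => ?_)
  show (if hz : (y : Metric.closedBall (0 : EuclideanSpace ℝ (Fin 4)) 1) ∈ handleTube 3 2 then K ⟨y, hz⟩ else J y₀) = K y
  rw [dif_pos y.2]

end TubeImmersion

/-- **Registered helper `helper_isImmersionAt_of_eq_comp_selfPush` (tool brick for (ii-2) of T3b,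
sub-goal of NF6 `stub_steinRealisation`, wave 4, lead c5): the push `Ĵ ∘ selfPush κ δ` of an
immersion `Ĵ` of Kosinski's tube off the attaching circle is an immersion of the whole tube.**
[cite: LeeSmoothManifolds2013, Thm. 4.15] -/
theorem helper_isImmersionAt_of_eq_comp_selfPush : ∀ {N : Type*} [TopologicalSpace N] [ChartedSpace (EuclideanSpace ℝ (Fin 4)) N] [IsManifold (𝓡 4) ∞ N] {κ δ : ℝ}, 0 < κ → κ ≤ 1 / 2 → 0 < δ → δ ≤ 1 / 2 → ∀ {J K : ↥(Literature.Topology.FourManifolds.handleTube 3 2) → N}, (∀ y : ↥(Literature.Topology.FourManifolds.handleTube 3 2), Literature.Topology.FourManifolds.lamSq 2 (((y : Metric.closedBall (0 : EuclideanSpace ℝ (Fin 4)) 1) : EuclideanSpace ℝ (Fin 4))) ≠ 1 → Manifold.IsImmersionAt (𝓡∂ 4) (𝓡 4) ∞ J y) → (∀ y y' : ↥(Literature.Topology.FourManifolds.handleTube 3 2), (((y' : Metric.closedBall (0 : EuclideanSpace ℝ (Fin 4)) 1) : EuclideanSpace ℝ (Fin 4)) = Summit.SmoothPoincare4.SmoothPoincare4.Theorems.AcyclicBisectionExists.ModpBraidOrbits.PushModel.selfPush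 κ δ ((y : Metric.closedBall (0 : EuclideanSpace ℝ (Fin 4)) 1) : EuclideanSpace ℝ (Fin 4))) → K y = J y') → ∀ y₀ : ↥(Literature.Topology.FourManifolds.handleTube 3 2), Manifold.IsImmersionAt (𝓡∂ 4) (𝓡 4) ∞ K y₀ := by
  intro N _ _ _ κ δ hκ hκ2 hδ hδ2 J K hJ hK y₀
  exact isImmersionAt_of_eq_comp_selfPush hκ hκ2 hδ hδ2 hJ hK y₀

end Summit.SmoothPoincare4.SmoothPoincare4.Theorems.AcyclicBisectionExists.ModpBraidOrbits

end
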